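import Literature.Probability.RandomPlanarGeometry.HexSAWSurfaceWallRenewalSlackTwoClassification
import HarnessLib

/-!
# Irreducible wall bridges at slack four with four down steps: the body runs, order by order

Literature layer — sorry-free.  Held sources: [MS] N. Madras, G. Slade, *The Self-Avoiding Walk* (1993), §4.2
(irreducible bridges and the renewal structure, Definition 4.2.1, (4.2.2)); [EJ] I. G. Enting, I. Jensen, in
*Polygons, Polyominoes and Polycubes* (2009), §7.4.2 (transfer matrices for walks attached to a surface, Fig. 7.10);
the wall-renewal census itself is OURS (project `HexSAWSurfaceWallRenewal*`).

For an irreducible positive wall bridge `ω ∈ ipwb m` of the brick-wall frame at slack four (`m = 6k + 4`, `k` visits)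
with exactly four down steps at times `p₁ < p₂ < p₃ < p₄` and four up steps at `r₁ < r₂ < r₃ < r₄` (the profile of
`profile_of_card_stepsD_eq_four`), this module records, for each of the four vertical orders whose interior stays
strictly below the wall,

* `D D D D U U U U` (`dddduuuu4_runs`), `D D D U D U U U` (`ddduduuu4_runs`), `D D D U U D U U` (`ddduuduu4_runs`) and
  `D D U D D U U U` (`ddudduuu4_runs`),

the seven body runs between consecutive vertical steps (each a monotone run of sign `eⱼ ∈ {1, −1}` on its row, by
`run_const_velocity`), the rightward final run along the wall, the visit count `r₄ + 2k + 1 = m + p₁` (so the span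
reads `X + p₁ = ω r₄ 0 + 2k`), the column parities forced by the frame, positivity of the interior columns, and the
gaps `≥ 2` between consecutive vertical steps of types `D D`, `D U`, `U D`.  These are the four-down analogues of
`ddduuu4_runs` (`…SlackFourThreeDownRuns`), with the same proof; they are step (ii) of the classification of the
four-down stratum of the slack-four row (the fifth occurring order `D D U U D D U U` returns to the wall in between and
is not treated here).  OURS (routine tools); no new definitions.
-/

namespace Literature.Probability.RandomPlanarGeometry.SAW.HexBW.Wall

open Finset Filter Function
open Literature.Probability.LatticeModels Literature.Probability.Percolation SimpleGraph

variable {ω : ℕ → Site 2}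

/-- [folklore] Two coordinates determine a site of `ℤ²`. -/
private theorem site_ext_d4r {p q : Site 2} (h0 : p 0 = q 0) (h1 : p 1 = q 1) : p = q := by
  funext k
  fin_cases k
  · exact h0
  · exact h1

/-- [folklore] Slack-four numerics: the visit count `p / 2 + (m − r) / 2 = k` with `p` odd and `r` even gives the
length `m − r − 1 = 2k − p` of the final wall run. -/
private theorem wall_run_length_d4 {k m p r : ℕ} (hm : m = 6 * k + 4) (hv : p / 2 + (m - r) / 2 = k) (hp : p % 2 = 1)
    (hr : r % 2 = 0) (hrm : r < m) : r + 2 * k + 1 = m + p := by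
  omega

/-- **Order `D D D D U U U U` at slack four: the seven body runs.**  For `m = 6k + 4`, `k` visits, four down times
`p₁ < p₂ < p₃ < p₄` and four up times `r₁ < r₂ < r₃ < r₄` interleaved in the order `D D D D U U U U`: between consecutive
vertical steps the walk is a monotone run of sign `eⱼ ∈ {1, −1}` on the rows `−1, −2, −3, −4, −3, −2, −1`, the final run returns
rightwards along the wall, the visit count reads `r₄ + 2k + 1 = m + p₁` (so `X + p₁ = ω r₄ 0 + 2k`), the columns at
the vertical steps have the parities forced by the brick-wall frame, the interior ones are positive, and consecutive
vertical steps of types `D D` / `D U` / `U D` are `≥ 2` apart.  Analogue of `ddduuu4_runs` (`…SlackFourThreeDownRuns`),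
same proof. OURS (routine tool). [cite: MadrasSlade1993, §4.2, Definition 4.2.1 (p. 90), (4.2.2)]
[cite: EntingJensen2009, §7.4.2, Fig. 7.10] -/
theorem dddduuuu4_runs {k m : ℕ} (hm : m = 6 * k + 4) (hω : ω ∈ ipwb m) (hv : visits m ω = k)
    {p₁ p₂ p₃ p₄ r₁ r₂ r₃ r₄ : ℕ} (hD : stepsD m ω = {p₁, p₂, p₃, p₄}) (hU : stepsU m ω = {r₁, r₂, r₃, r₄})
    (h12 : p₁ < p₂) (h23 : p₂ < p₃) (h34 : p₃ < p₄) (hr12 : r₁ < r₂) (hr23 : r₂ < r₃) (hr34 : r₃ < r₄)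
    (ht4 : p₄ < r₁) (hp1 : 1 ≤ p₁) (hR0 : ∀ i, i ≤ p₁ → ω i 0 = i ∧ ω i 1 = 0)
    (hP1x : ω (p₁ + 1) 0 = p₁) (hP1y : ω (p₁ + 1) 1 = -1)
    (hhor : ∀ i, i < m → i ∉ stepsD m ω → i ∉ stepsU m ω →
      ω (i + 1) 1 = ω i 1 ∧ (ω (i + 1) 0 = ω i 0 + 1 ∨ ω (i + 1) 0 = ω i 0 - 1)) :
    ∃ e₁ e₂ e₃ e₄ e₅ e₆ e₇ : ℤ, (e₁ = 1 ∨ e₁ = -1) ∧ (e₂ = 1 ∨ e₂ = -1) ∧ (e₃ = 1 ∨ e₃ = -1) ∧ (e₄ = 1 ∨ e₄ = -1) ∧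
      (e₅ = 1 ∨ e₅ = -1) ∧ (e₆ = 1 ∨ e₆ = -1) ∧ (e₇ = 1 ∨ e₇ = -1) ∧
      (∀ i, p₁ + 1 ≤ i → i ≤ p₂ → ω i 0 = p₁ + e₁ * ((i - (p₁ + 1) : ℕ) : ℤ) ∧ ω i 1 = -1) ∧
      (∀ i, p₂ + 1 ≤ i → i ≤ p₃ → ω i 0 = ω p₂ 0 + e₂ * ((i - (p₂ + 1) : ℕ) : ℤ) ∧ ω i 1 = -2) ∧
      (∀ i, p₃ + 1 ≤ i → i ≤ p₄ → ω i 0 = ω p₃ 0 + e₃ * ((i - (p₃ + 1) : ℕ) : ℤ) ∧ ω i 1 = -3) ∧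
      (∀ i, p₄ + 1 ≤ i → i ≤ r₁ → ω i 0 = ω p₄ 0 + e₄ * ((i - (p₄ + 1) : ℕ) : ℤ) ∧ ω i 1 = -4) ∧
      (∀ i, r₁ + 1 ≤ i → i ≤ r₂ → ω i 0 = ω r₁ 0 + e₅ * ((i - (r₁ + 1) : ℕ) : ℤ) ∧ ω i 1 = -3) ∧
      (∀ i, r₂ + 1 ≤ i → i ≤ r₃ → ω i 0 = ω r₂ 0 + e₆ * ((i - (r₂ + 1) : ℕ) : ℤ) ∧ ω i 1 = -2) ∧
      (∀ i, r₃ + 1 ≤ i → i ≤ r₄ → ω i 0 = ω r₃ 0 + e₇ * ((i - (r₃ + 1) : ℕ) : ℤ) ∧ ω i 1 = -1) ∧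
      (∀ j, r₄ + 1 ≤ j → j ≤ m → ω j 0 = ω r₄ 0 + ((j - (r₄ + 1) : ℕ) : ℤ) ∧ ω j 1 = 0) ∧
      r₄ + 2 * k + 1 = m + p₁ ∧ ω m 0 + p₁ = ω r₄ 0 + 2 * k ∧
      ω p₂ 0 % 2 = 0 ∧ ω p₃ 0 % 2 = 1 ∧ ω p₄ 0 % 2 = 0 ∧ ω r₁ 0 % 2 = 0 ∧ ω r₂ 0 % 2 = 1 ∧ ω r₃ 0 % 2 = 0 ∧
      ω r₄ 0 % 2 = 1 ∧ 0 < ω p₂ 0 ∧ 0 < ω p₃ 0 ∧ 0 < ω p₄ 0 ∧ 0 < ω r₁ 0 ∧ 0 < ω r₂ 0 ∧ 0 < ω r₃ 0 ∧ p₁ + 2 ≤ p₂ ∧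
      p₂ + 2 ≤ p₃ ∧ p₃ + 2 ≤ p₄ ∧ p₄ + 2 ≤ r₁ ∧ r₄ < m := by
  classical
  obtain ⟨hpw, hn1, hirr⟩ := mem_ipwb.1 hω
  obtain ⟨hw, hb⟩ := mem_pwb.1 hpw
  obtain ⟨ha, -⟩ := mem_wbr.1 hw
  obtain ⟨hh, -, -⟩ := mem_archs.1 ha
  obtain ⟨hs, hhp⟩ := mem_hpw.1 hh
  obtain ⟨h0, -, hbw, hinj⟩ := mem_saws_iff.1 hs
  have hX0 : ω 0 0 = 0 := by rw [h0]; rfl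
  have hb' : ∀ i, 1 ≤ i → i ≤ m → 0 < ω i 0 ∧ ω i 0 ≤ ω m 0 := fun i h1 h2 => by
    have := hb i h1 h2; rwa [hX0] at this
  have hmem : ∀ i, i ≤ m → i ∈ {i | i ≤ m} := fun i hi => hi
  have hmD : ∀ i, i ∈ stepsD m ω ↔ i = p₁ ∨ i = p₂ ∨ i = p₃ ∨ i = p₄ := fun i => by
    rw [hD]; simp only [Finset.mem_insert, Finset.mem_singleton]
  have hmU : ∀ i, i ∈ stepsU m ω ↔ i = r₁ ∨ i = r₂ ∨ i = r₃ ∨ i = r₄ := fun i => by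
    rw [hU]; simp only [Finset.mem_insert, Finset.mem_singleton]
  obtain ⟨-, -, -, hpar_p₁⟩ := of_mem_stepsD_coord hbw (i := p₁) ((hmD _).2 (by simp))
  obtain ⟨hn_p₂, hx_p₂, hys_p₂, hpar_p₂⟩ := of_mem_stepsD_coord hbw (i := p₂) ((hmD _).2 (by simp))
  obtain ⟨hn_p₃, hx_p₃, hys_p₃, hpar_p₃⟩ := of_mem_stepsD_coord hbw (i := p₃) ((hmD _).2 (by simp))
  obtain ⟨hn_p₄, hx_p₄, hys_p₄, hpar_p₄⟩ := of_mem_stepsD_coord hbw (i := p₄) ((hmD _).2 (by simp))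
  obtain ⟨hn_r₁, hx_r₁, hys_r₁, hpar_r₁⟩ := of_mem_stepsU_coord hbw (i := r₁) ((hmU _).2 (by simp))
  obtain ⟨hn_r₂, hx_r₂, hys_r₂, hpar_r₂⟩ := of_mem_stepsU_coord hbw (i := r₂) ((hmU _).2 (by simp))
  obtain ⟨hn_r₃, hx_r₃, hys_r₃, hpar_r₃⟩ := of_mem_stepsU_coord hbw (i := r₃) ((hmU _).2 (by simp))
  obtain ⟨hn_r₄, hx_r₄, hys_r₄, hpar_r₄⟩ := of_mem_stepsU_coord hbw (i := r₄) ((hmU _).2 (by simp))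
  have hhor' : ∀ i, i < m → i ≠ p₁ → i ≠ p₂ → i ≠ p₃ → i ≠ p₄ → i ≠ r₁ → i ≠ r₂ → i ≠ r₃ → i ≠ r₄ →
      ω (i + 1) 1 = ω i 1 ∧ (ω (i + 1) 0 = ω i 0 + 1 ∨ ω (i + 1) 0 = ω i 0 - 1) :=
    fun i hi n1 n2 n3 n4 n5 n6 n7 n8 => hhor i hi (by rw [hmD]; omega) (by rw [hmU]; omega)
  -- run 1 on row `−1`
  obtain ⟨e1, he1, hrun1⟩ := run_const_velocity hinj (a := p₁ + 1) (b := p₂) (by omega) (by omega)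
    (fun i hi1 hi2 => hhor' i (by omega) (by omega) (by omega) (by omega) (by omega) (by omega) (by omega) (by omega) (by omega))
  have hy_p₂ : ω p₂ 1 = -1 := by rw [(hrun1 p₂ (by omega) le_rfl).2, hP1y]
  have hy1_p₂ : ω (p₂ + 1) 1 = -2 := by rw [hys_p₂, hy_p₂]; rfl
  have hparc_p₂ : ω p₂ 0 % 2 = 0 := by rw [hx_p₂, hy1_p₂] at hpar_p₂; omega
  have hpos_p₂ := (hb' p₂ (by omega) (by omega)).1
  -- run 2 on row `−2`
  obtain ⟨e2, he2, hrun2⟩ := run_const_velocity hinj (a := p₂ + 1) (b := p₃) (by omega) (by omega)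
    (fun i hi1 hi2 => hhor' i (by omega) (by omega) (by omega) (by omega) (by omega) (by omega) (by omega) (by omega) (by omega))
  have hy_p₃ : ω p₃ 1 = -2 := by rw [(hrun2 p₃ (by omega) le_rfl).2, hy1_p₂]
  have hy1_p₃ : ω (p₃ + 1) 1 = -3 := by rw [hys_p₃, hy_p₃]; rfl
  have hparc_p₃ : ω p₃ 0 % 2 = 1 := by rw [hx_p₃, hy1_p₃] at hpar_p₃; omega
  have hpos_p₃ := (hb' p₃ (by omega) (by omega)).1
  -- run 3 on row `−3`
  obtain ⟨e3, he3, hrun3⟩ := run_const_velocity hinj (a := p₃ + 1) (b := p₄) (by omega) (by omega)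
    (fun i hi1 hi2 => hhor' i (by omega) (by omega) (by omega) (by omega) (by omega) (by omega) (by omega) (by omega) (by omega))
  have hy_p₄ : ω p₄ 1 = -3 := by rw [(hrun3 p₄ (by omega) le_rfl).2, hy1_p₃]
  have hy1_p₄ : ω (p₄ + 1) 1 = -4 := by rw [hys_p₄, hy_p₄]; rfl
  have hparc_p₄ : ω p₄ 0 % 2 = 0 := by rw [hx_p₄, hy1_p₄] at hpar_p₄; omega
  have hpos_p₄ := (hb' p₄ (by omega) (by omega)).1
  -- run 4 on row `−4`
  obtain ⟨e4, he4, hrun4⟩ := run_const_velocity hinj (a := p₄ + 1) (b := r₁) (by omega) (by omega)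
    (fun i hi1 hi2 => hhor' i (by omega) (by omega) (by omega) (by omega) (by omega) (by omega) (by omega) (by omega) (by omega))
  have hy_r₁ : ω r₁ 1 = -4 := by rw [(hrun4 r₁ (by omega) le_rfl).2, hy1_p₄]
  have hy1_r₁ : ω (r₁ + 1) 1 = -3 := by rw [hys_r₁, hy_r₁]; rfl
  have hparc_r₁ : ω r₁ 0 % 2 = 0 := by rw [hy_r₁] at hpar_r₁; omega
  have hpos_r₁ := (hb' r₁ (by omega) (by omega)).1
  -- run 5 on row `−3`
  obtain ⟨e5, he5, hrun5⟩ := run_const_velocity hinj (a := r₁ + 1) (b := r₂) (by omega) (by omega)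
    (fun i hi1 hi2 => hhor' i (by omega) (by omega) (by omega) (by omega) (by omega) (by omega) (by omega) (by omega) (by omega))
  have hy_r₂ : ω r₂ 1 = -3 := by rw [(hrun5 r₂ (by omega) le_rfl).2, hy1_r₁]
  have hy1_r₂ : ω (r₂ + 1) 1 = -2 := by rw [hys_r₂, hy_r₂]; rfl
  have hparc_r₂ : ω r₂ 0 % 2 = 1 := by rw [hy_r₂] at hpar_r₂; omega
  have hpos_r₂ := (hb' r₂ (by omega) (by omega)).1
  -- run 6 on row `−2`
  obtain ⟨e6, he6, hrun6⟩ := run_const_velocity hinj (a := r₂ + 1) (b := r₃) (by omega) (by omega)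
    (fun i hi1 hi2 => hhor' i (by omega) (by omega) (by omega) (by omega) (by omega) (by omega) (by omega) (by omega) (by omega))
  have hy_r₃ : ω r₃ 1 = -2 := by rw [(hrun6 r₃ (by omega) le_rfl).2, hy1_r₂]
  have hy1_r₃ : ω (r₃ + 1) 1 = -1 := by rw [hys_r₃, hy_r₃]; rfl
  have hparc_r₃ : ω r₃ 0 % 2 = 0 := by rw [hy_r₃] at hpar_r₃; omega
  have hpos_r₃ := (hb' r₃ (by omega) (by omega)).1
  -- run 7 on row `−1`
  obtain ⟨e7, he7, hrun7⟩ := run_const_velocity hinj (a := r₃ + 1) (b := r₄) (by omega) (by omega)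
    (fun i hi1 hi2 => hhor' i (by omega) (by omega) (by omega) (by omega) (by omega) (by omega) (by omega) (by omega) (by omega))
  have hy_r₄ : ω r₄ 1 = -1 := by rw [(hrun7 r₄ (by omega) le_rfl).2, hy1_r₃]
  have hy1_r₄ : ω (r₄ + 1) 1 = 0 := by rw [hys_r₄, hy_r₄]; rfl
  have hparc_r₄ : ω r₄ 0 % 2 = 1 := by rw [hy_r₄] at hpar_r₄; omega
  have hsev : r₄ % 2 = 0 := by have := parity_apply hs (show r₄ ≤ m by omega); rw [hy_r₄] at this; omega
  -- run 8 on the wall goes right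
  obtain ⟨e8, he8, hrun8⟩ := run_const_velocity hinj (a := r₄ + 1) (b := m) (by omega) le_rfl
    (fun i hi1 hi2 => hhor' i (by omega) (by omega) (by omega) (by omega) (by omega) (by omega) (by omega) (by omega)
      (by omega))
  obtain rfl : e8 = 1 := by
    rcases he8 with h | rfl
    · exact h
    exfalso
    have hN := (hrun8 m (by omega) le_rfl).1
    have hbn := (hb' (r₄ + 1) (by omega) (by omega)).2
    rw [hx_r₄] at hN hbn
    omega
  have hR8 : ∀ j, r₄ + 1 ≤ j → j ≤ m → ω j 0 = ω r₄ 0 + ((j - (r₄ + 1) : ℕ) : ℤ) ∧ ω j 1 = 0 := fun j hj1 hj2 => by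
    obtain ⟨hx, hy⟩ := hrun8 j hj1 hj2
    rw [hx_r₄] at hx; rw [hy1_r₄] at hy
    exact ⟨by rw [hx]; ring, hy⟩
  -- the visit count
  have hvf : visits m ω = p₁ / 2 + (m - r₄) / 2 := by
    have hv1 : visits p₁ ω = p₁ / 2 := visits_eq_div_two_of_wall (fun i _ hi2 => (hR0 i hi2).2)
    have hv2 : visits r₄ ω = visits p₁ ω := by
      have := visits_add_eq_left (k := p₁) (b := r₄ - p₁) (ζ := ω) (fun j hj1 hj2 => ?_)
      · rwa [show p₁ + (r₄ - p₁) = r₄ by omega] at this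
      rintro ⟨-, hy⟩
      rcases Nat.lt_or_ge (p₁ + j) (p₂ + 1) with hj1' | hj1
      · have := (hrun1 (p₁ + j) (by omega) (by omega)).2; rw [hP1y] at this; omega
      rcases Nat.lt_or_ge (p₁ + j) (p₃ + 1) with hj2' | hj2
      · have := (hrun2 (p₁ + j) hj1 (by omega)).2; rw [hy1_p₂] at this; omega
      rcases Nat.lt_or_ge (p₁ + j) (p₄ + 1) with hj3' | hj3
      · have := (hrun3 (p₁ + j) hj2 (by omega)).2; rw [hy1_p₃] at this; omega
      rcases Nat.lt_or_ge (p₁ + j) (r₁ + 1) with hj4' | hj4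
      · have := (hrun4 (p₁ + j) hj3 (by omega)).2; rw [hy1_p₄] at this; omega
      rcases Nat.lt_or_ge (p₁ + j) (r₂ + 1) with hj5' | hj5
      · have := (hrun5 (p₁ + j) hj4 (by omega)).2; rw [hy1_r₁] at this; omega
      rcases Nat.lt_or_ge (p₁ + j) (r₃ + 1) with hj6' | hj6
      · have := (hrun6 (p₁ + j) hj5 (by omega)).2; rw [hy1_r₂] at this; omega
      · have := (hrun7 (p₁ + j) hj6 (by omega)).2; rw [hy1_r₃] at this; omega
    have hv3 : visits m ω = visits r₄ ω + visits (m - r₄) (fun _ => (0 : Site 2)) := by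
      have := visits_add (a := r₄) (b := m - r₄) (ζ := ω) (ξ := fun _ => (0 : Site 2)) hsev (fun j hj1 hj2 => ?_)
      · rwa [show r₄ + (m - r₄) = m by omega] at this
      rw [(hR8 (r₄ + j) (by omega) (by omega)).2]; rfl
    have hv4 : visits (m - r₄) (fun _ => (0 : Site 2)) = (m - r₄) / 2 := visits_eq_div_two_of_wall (fun i _ _ => rfl)
    rw [hv3, hv2, hv1, hv4]
  rw [hvf] at hv
  have hpodd : p₁ % 2 = 1 := by rw [hP1x, hP1y] at hpar_p₁; omega
  have hs_eq : r₄ + 2 * k + 1 = m + p₁ := wall_run_length_d4 hm hv hpodd hsev hn_r₄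
  have hN' : ω m 0 + p₁ = ω r₄ 0 + 2 * k := by
    rw [(hR8 m (by omega) le_rfl).1]; omega
  -- gaps between consecutive vertical steps
  have hgap1 : p₁ + 2 ≤ p₂ := by
    by_contra h
    obtain rfl : p₂ = p₁ + 1 := by omega
    rw [hx_p₂, hP1x] at hpar_p₂; rw [hy1_p₂] at hpar_p₂; omega
  have hgap2 : p₂ + 2 ≤ p₃ := by
    by_contra h
    obtain rfl : p₃ = p₂ + 1 := by omega
    rw [hx_p₃, hx_p₂] at hpar_p₃; rw [hy1_p₃] at hpar_p₃; rw [hx_p₂, hy1_p₂] at hpar_p₂; omega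
  have hgap3 : p₃ + 2 ≤ p₄ := by
    by_contra h
    obtain rfl : p₄ = p₃ + 1 := by omega
    rw [hx_p₄, hx_p₃] at hpar_p₄; rw [hy1_p₄] at hpar_p₄; rw [hx_p₃, hy1_p₃] at hpar_p₃; omega
  have hgap4 : p₄ + 2 ≤ r₁ := by
    by_contra h
    obtain rfl : r₁ = p₄ + 1 := by omega
    have := hinj (hmem (p₄ + 1 + 1) (by omega)) (hmem p₄ (by omega))
      (site_ext_d4r (by rw [hx_r₁, hx_p₄]) (by rw [hy1_r₁, hy_p₄]))
    omega
  refine ⟨e1, e2, e3, e4, e5, e6, e7, he1, he2, he3, he4, he5, he6, he7,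
    fun i hi1 hi2 => ⟨by rw [(hrun1 i hi1 hi2).1, hP1x], by rw [(hrun1 i hi1 hi2).2, hP1y]⟩,
    fun i hi1 hi2 => ⟨by rw [(hrun2 i hi1 hi2).1, hx_p₂], by rw [(hrun2 i hi1 hi2).2, hy1_p₂]⟩,
    fun i hi1 hi2 => ⟨by rw [(hrun3 i hi1 hi2).1, hx_p₃], by rw [(hrun3 i hi1 hi2).2, hy1_p₃]⟩,
    fun i hi1 hi2 => ⟨by rw [(hrun4 i hi1 hi2).1, hx_p₄], by rw [(hrun4 i hi1 hi2).2, hy1_p₄]⟩,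
    fun i hi1 hi2 => ⟨by rw [(hrun5 i hi1 hi2).1, hx_r₁], by rw [(hrun5 i hi1 hi2).2, hy1_r₁]⟩,
    fun i hi1 hi2 => ⟨by rw [(hrun6 i hi1 hi2).1, hx_r₂], by rw [(hrun6 i hi1 hi2).2, hy1_r₂]⟩,
    fun i hi1 hi2 => ⟨by rw [(hrun7 i hi1 hi2).1, hx_r₃], by rw [(hrun7 i hi1 hi2).2, hy1_r₃]⟩,
    hR8, hs_eq, hN', hparc_p₂, hparc_p₃, hparc_p₄, hparc_r₁, hparc_r₂, hparc_r₃, hparc_r₄,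
    hpos_p₂, hpos_p₃, hpos_p₄, hpos_r₁, hpos_r₂, hpos_r₃, hgap1, hgap2, hgap3, hgap4, hn_r₄⟩

/-- **Order `D D D U D U U U` at slack four: the seven body runs.**  For `m = 6k + 4`, `k` visits, four down times
`p₁ < p₂ < p₃ < p₄` and four up times `r₁ < r₂ < r₃ < r₄` interleaved in the order `D D D U D U U U`: between consecutive
vertical steps the walk is a monotone run of sign `eⱼ ∈ {1, −1}` on the rows `−1, −2, −3, −2, −3, −2, −1`, the final run returns
rightwards along the wall, the visit count reads `r₄ + 2k + 1 = m + p₁` (so `X + p₁ = ω r₄ 0 + 2k`), the columns at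
the vertical steps have the parities forced by the brick-wall frame, the interior ones are positive, and consecutive
vertical steps of types `D D` / `D U` / `U D` are `≥ 2` apart.  Analogue of `ddduuu4_runs` (`…SlackFourThreeDownRuns`),
same proof. OURS (routine tool). [cite: MadrasSlade1993, §4.2, Definition 4.2.1 (p. 90), (4.2.2)]
[cite: EntingJensen2009, §7.4.2, Fig. 7.10] -/
theorem ddduduuu4_runs {k m : ℕ} (hm : m = 6 * k + 4) (hω : ω ∈ ipwb m) (hv : visits m ω = k)
    {p₁ p₂ p₃ p₄ r₁ r₂ r₃ r₄ : ℕ} (hD : stepsD m ω = {p₁, p₂, p₃, p₄}) (hU : stepsU m ω = {r₁, r₂, r₃, r₄})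
    (h12 : p₁ < p₂) (h23 : p₂ < p₃) (h34 : p₃ < p₄) (hr12 : r₁ < r₂) (hr23 : r₂ < r₃) (hr34 : r₃ < r₄)
    (ht3 : p₃ < r₁) (ht4 : r₁ < p₄) (ht5 : p₄ < r₂) (hp1 : 1 ≤ p₁) (hR0 : ∀ i, i ≤ p₁ → ω i 0 = i ∧ ω i 1 = 0)
    (hP1x : ω (p₁ + 1) 0 = p₁) (hP1y : ω (p₁ + 1) 1 = -1)
    (hhor : ∀ i, i < m → i ∉ stepsD m ω → i ∉ stepsU m ω →
      ω (i + 1) 1 = ω i 1 ∧ (ω (i + 1) 0 = ω i 0 + 1 ∨ ω (i + 1) 0 = ω i 0 - 1)) :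
    ∃ e₁ e₂ e₃ e₄ e₅ e₆ e₇ : ℤ, (e₁ = 1 ∨ e₁ = -1) ∧ (e₂ = 1 ∨ e₂ = -1) ∧ (e₃ = 1 ∨ e₃ = -1) ∧ (e₄ = 1 ∨ e₄ = -1) ∧
      (e₅ = 1 ∨ e₅ = -1) ∧ (e₆ = 1 ∨ e₆ = -1) ∧ (e₇ = 1 ∨ e₇ = -1) ∧
      (∀ i, p₁ + 1 ≤ i → i ≤ p₂ → ω i 0 = p₁ + e₁ * ((i - (p₁ + 1) : ℕ) : ℤ) ∧ ω i 1 = -1) ∧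
      (∀ i, p₂ + 1 ≤ i → i ≤ p₃ → ω i 0 = ω p₂ 0 + e₂ * ((i - (p₂ + 1) : ℕ) : ℤ) ∧ ω i 1 = -2) ∧
      (∀ i, p₃ + 1 ≤ i → i ≤ r₁ → ω i 0 = ω p₃ 0 + e₃ * ((i - (p₃ + 1) : ℕ) : ℤ) ∧ ω i 1 = -3) ∧
      (∀ i, r₁ + 1 ≤ i → i ≤ p₄ → ω i 0 = ω r₁ 0 + e₄ * ((i - (r₁ + 1) : ℕ) : ℤ) ∧ ω i 1 = -2) ∧
      (∀ i, p₄ + 1 ≤ i → i ≤ r₂ → ω i 0 = ω p₄ 0 + e₅ * ((i - (p₄ + 1) : ℕ) : ℤ) ∧ ω i 1 = -3) ∧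
      (∀ i, r₂ + 1 ≤ i → i ≤ r₃ → ω i 0 = ω r₂ 0 + e₆ * ((i - (r₂ + 1) : ℕ) : ℤ) ∧ ω i 1 = -2) ∧
      (∀ i, r₃ + 1 ≤ i → i ≤ r₄ → ω i 0 = ω r₃ 0 + e₇ * ((i - (r₃ + 1) : ℕ) : ℤ) ∧ ω i 1 = -1) ∧
      (∀ j, r₄ + 1 ≤ j → j ≤ m → ω j 0 = ω r₄ 0 + ((j - (r₄ + 1) : ℕ) : ℤ) ∧ ω j 1 = 0) ∧
      r₄ + 2 * k + 1 = m + p₁ ∧ ω m 0 + p₁ = ω r₄ 0 + 2 * k ∧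
      ω p₂ 0 % 2 = 0 ∧ ω p₃ 0 % 2 = 1 ∧ ω r₁ 0 % 2 = 1 ∧ ω p₄ 0 % 2 = 1 ∧ ω r₂ 0 % 2 = 1 ∧ ω r₃ 0 % 2 = 0 ∧
      ω r₄ 0 % 2 = 1 ∧ 0 < ω p₂ 0 ∧ 0 < ω p₃ 0 ∧ 0 < ω r₁ 0 ∧ 0 < ω p₄ 0 ∧ 0 < ω r₂ 0 ∧ 0 < ω r₃ 0 ∧ p₁ + 2 ≤ p₂ ∧
      p₂ + 2 ≤ p₃ ∧ p₃ + 2 ≤ r₁ ∧ r₁ + 2 ≤ p₄ ∧ p₄ + 2 ≤ r₂ ∧ r₄ < m := by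
  classical
  obtain ⟨hpw, hn1, hirr⟩ := mem_ipwb.1 hω
  obtain ⟨hw, hb⟩ := mem_pwb.1 hpw
  obtain ⟨ha, -⟩ := mem_wbr.1 hw
  obtain ⟨hh, -, -⟩ := mem_archs.1 ha
  obtain ⟨hs, hhp⟩ := mem_hpw.1 hh
  obtain ⟨h0, -, hbw, hinj⟩ := mem_saws_iff.1 hs
  have hX0 : ω 0 0 = 0 := by rw [h0]; rfl
  have hb' : ∀ i, 1 ≤ i → i ≤ m → 0 < ω i 0 ∧ ω i 0 ≤ ω m 0 := fun i h1 h2 => by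
    have := hb i h1 h2; rwa [hX0] at this
  have hmem : ∀ i, i ≤ m → i ∈ {i | i ≤ m} := fun i hi => hi
  have hmD : ∀ i, i ∈ stepsD m ω ↔ i = p₁ ∨ i = p₂ ∨ i = p₃ ∨ i = p₄ := fun i => by
    rw [hD]; simp only [Finset.mem_insert, Finset.mem_singleton]
  have hmU : ∀ i, i ∈ stepsU m ω ↔ i = r₁ ∨ i = r₂ ∨ i = r₃ ∨ i = r₄ := fun i => by
    rw [hU]; simp only [Finset.mem_insert, Finset.mem_singleton]
  obtain ⟨-, -, -, hpar_p₁⟩ := of_mem_stepsD_coord hbw (i := p₁) ((hmD _).2 (by simp))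
  obtain ⟨hn_p₂, hx_p₂, hys_p₂, hpar_p₂⟩ := of_mem_stepsD_coord hbw (i := p₂) ((hmD _).2 (by simp))
  obtain ⟨hn_p₃, hx_p₃, hys_p₃, hpar_p₃⟩ := of_mem_stepsD_coord hbw (i := p₃) ((hmD _).2 (by simp))
  obtain ⟨hn_r₁, hx_r₁, hys_r₁, hpar_r₁⟩ := of_mem_stepsU_coord hbw (i := r₁) ((hmU _).2 (by simp))
  obtain ⟨hn_p₄, hx_p₄, hys_p₄, hpar_p₄⟩ := of_mem_stepsD_coord hbw (i := p₄) ((hmD _).2 (by simp))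
  obtain ⟨hn_r₂, hx_r₂, hys_r₂, hpar_r₂⟩ := of_mem_stepsU_coord hbw (i := r₂) ((hmU _).2 (by simp))
  obtain ⟨hn_r₃, hx_r₃, hys_r₃, hpar_r₃⟩ := of_mem_stepsU_coord hbw (i := r₃) ((hmU _).2 (by simp))
  obtain ⟨hn_r₄, hx_r₄, hys_r₄, hpar_r₄⟩ := of_mem_stepsU_coord hbw (i := r₄) ((hmU _).2 (by simp))
  have hhor' : ∀ i, i < m → i ≠ p₁ → i ≠ p₂ → i ≠ p₃ → i ≠ p₄ → i ≠ r₁ → i ≠ r₂ → i ≠ r₃ → i ≠ r₄ →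
      ω (i + 1) 1 = ω i 1 ∧ (ω (i + 1) 0 = ω i 0 + 1 ∨ ω (i + 1) 0 = ω i 0 - 1) :=
    fun i hi n1 n2 n3 n4 n5 n6 n7 n8 => hhor i hi (by rw [hmD]; omega) (by rw [hmU]; omega)
  -- run 1 on row `−1`
  obtain ⟨e1, he1, hrun1⟩ := run_const_velocity hinj (a := p₁ + 1) (b := p₂) (by omega) (by omega)
    (fun i hi1 hi2 => hhor' i (by omega) (by omega) (by omega) (by omega) (by omega) (by omega) (by omega) (by omega) (by omega))
  have hy_p₂ : ω p₂ 1 = -1 := by rw [(hrun1 p₂ (by omega) le_rfl).2, hP1y]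
  have hy1_p₂ : ω (p₂ + 1) 1 = -2 := by rw [hys_p₂, hy_p₂]; rfl
  have hparc_p₂ : ω p₂ 0 % 2 = 0 := by rw [hx_p₂, hy1_p₂] at hpar_p₂; omega
  have hpos_p₂ := (hb' p₂ (by omega) (by omega)).1
  -- run 2 on row `−2`
  obtain ⟨e2, he2, hrun2⟩ := run_const_velocity hinj (a := p₂ + 1) (b := p₃) (by omega) (by omega)
    (fun i hi1 hi2 => hhor' i (by omega) (by omega) (by omega) (by omega) (by omega) (by omega) (by omega) (by omega) (by omega))
  have hy_p₃ : ω p₃ 1 = -2 := by rw [(hrun2 p₃ (by omega) le_rfl).2, hy1_p₂]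
  have hy1_p₃ : ω (p₃ + 1) 1 = -3 := by rw [hys_p₃, hy_p₃]; rfl
  have hparc_p₃ : ω p₃ 0 % 2 = 1 := by rw [hx_p₃, hy1_p₃] at hpar_p₃; omega
  have hpos_p₃ := (hb' p₃ (by omega) (by omega)).1
  -- run 3 on row `−3`
  obtain ⟨e3, he3, hrun3⟩ := run_const_velocity hinj (a := p₃ + 1) (b := r₁) (by omega) (by omega)
    (fun i hi1 hi2 => hhor' i (by omega) (by omega) (by omega) (by omega) (by omega) (by omega) (by omega) (by omega) (by omega))
  have hy_r₁ : ω r₁ 1 = -3 := by rw [(hrun3 r₁ (by omega) le_rfl).2, hy1_p₃]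
  have hy1_r₁ : ω (r₁ + 1) 1 = -2 := by rw [hys_r₁, hy_r₁]; rfl
  have hparc_r₁ : ω r₁ 0 % 2 = 1 := by rw [hy_r₁] at hpar_r₁; omega
  have hpos_r₁ := (hb' r₁ (by omega) (by omega)).1
  -- run 4 on row `−2`
  obtain ⟨e4, he4, hrun4⟩ := run_const_velocity hinj (a := r₁ + 1) (b := p₄) (by omega) (by omega)
    (fun i hi1 hi2 => hhor' i (by omega) (by omega) (by omega) (by omega) (by omega) (by omega) (by omega) (by omega) (by omega))
  have hy_p₄ : ω p₄ 1 = -2 := by rw [(hrun4 p₄ (by omega) le_rfl).2, hy1_r₁]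
  have hy1_p₄ : ω (p₄ + 1) 1 = -3 := by rw [hys_p₄, hy_p₄]; rfl
  have hparc_p₄ : ω p₄ 0 % 2 = 1 := by rw [hx_p₄, hy1_p₄] at hpar_p₄; omega
  have hpos_p₄ := (hb' p₄ (by omega) (by omega)).1
  -- run 5 on row `−3`
  obtain ⟨e5, he5, hrun5⟩ := run_const_velocity hinj (a := p₄ + 1) (b := r₂) (by omega) (by omega)
    (fun i hi1 hi2 => hhor' i (by omega) (by omega) (by omega) (by omega) (by omega) (by omega) (by omega) (by omega) (by omega))
  have hy_r₂ : ω r₂ 1 = -3 := by rw [(hrun5 r₂ (by omega) le_rfl).2, hy1_p₄]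
  have hy1_r₂ : ω (r₂ + 1) 1 = -2 := by rw [hys_r₂, hy_r₂]; rfl
  have hparc_r₂ : ω r₂ 0 % 2 = 1 := by rw [hy_r₂] at hpar_r₂; omega
  have hpos_r₂ := (hb' r₂ (by omega) (by omega)).1
  -- run 6 on row `−2`
  obtain ⟨e6, he6, hrun6⟩ := run_const_velocity hinj (a := r₂ + 1) (b := r₃) (by omega) (by omega)
    (fun i hi1 hi2 => hhor' i (by omega) (by omega) (by omega) (by omega) (by omega) (by omega) (by omega) (by omega) (by omega))
  have hy_r₃ : ω r₃ 1 = -2 := by rw [(hrun6 r₃ (by omega) le_rfl).2, hy1_r₂]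
  have hy1_r₃ : ω (r₃ + 1) 1 = -1 := by rw [hys_r₃, hy_r₃]; rfl
  have hparc_r₃ : ω r₃ 0 % 2 = 0 := by rw [hy_r₃] at hpar_r₃; omega
  have hpos_r₃ := (hb' r₃ (by omega) (by omega)).1
  -- run 7 on row `−1`
  obtain ⟨e7, he7, hrun7⟩ := run_const_velocity hinj (a := r₃ + 1) (b := r₄) (by omega) (by omega)
    (fun i hi1 hi2 => hhor' i (by omega) (by omega) (by omega) (by omega) (by omega) (by omega) (by omega) (by omega) (by omega))
  have hy_r₄ : ω r₄ 1 = -1 := by rw [(hrun7 r₄ (by omega) le_rfl).2, hy1_r₃]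
  have hy1_r₄ : ω (r₄ + 1) 1 = 0 := by rw [hys_r₄, hy_r₄]; rfl
  have hparc_r₄ : ω r₄ 0 % 2 = 1 := by rw [hy_r₄] at hpar_r₄; omega
  have hsev : r₄ % 2 = 0 := by have := parity_apply hs (show r₄ ≤ m by omega); rw [hy_r₄] at this; omega
  -- run 8 on the wall goes right
  obtain ⟨e8, he8, hrun8⟩ := run_const_velocity hinj (a := r₄ + 1) (b := m) (by omega) le_rfl
    (fun i hi1 hi2 => hhor' i (by omega) (by omega) (by omega) (by omega) (by omega) (by omega) (by omega) (by omega)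
      (by omega))
  obtain rfl : e8 = 1 := by
    rcases he8 with h | rfl
    · exact h
    exfalso
    have hN := (hrun8 m (by omega) le_rfl).1
    have hbn := (hb' (r₄ + 1) (by omega) (by omega)).2
    rw [hx_r₄] at hN hbn
    omega
  have hR8 : ∀ j, r₄ + 1 ≤ j → j ≤ m → ω j 0 = ω r₄ 0 + ((j - (r₄ + 1) : ℕ) : ℤ) ∧ ω j 1 = 0 := fun j hj1 hj2 => by
    obtain ⟨hx, hy⟩ := hrun8 j hj1 hj2
    rw [hx_r₄] at hx; rw [hy1_r₄] at hy
    exact ⟨by rw [hx]; ring, hy⟩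
  -- the visit count
  have hvf : visits m ω = p₁ / 2 + (m - r₄) / 2 := by
    have hv1 : visits p₁ ω = p₁ / 2 := visits_eq_div_two_of_wall (fun i _ hi2 => (hR0 i hi2).2)
    have hv2 : visits r₄ ω = visits p₁ ω := by
      have := visits_add_eq_left (k := p₁) (b := r₄ - p₁) (ζ := ω) (fun j hj1 hj2 => ?_)
      · rwa [show p₁ + (r₄ - p₁) = r₄ by omega] at this
      rintro ⟨-, hy⟩
      rcases Nat.lt_or_ge (p₁ + j) (p₂ + 1) with hj1' | hj1
      · have := (hrun1 (p₁ + j) (by omega) (by omega)).2; rw [hP1y] at this; omega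
      rcases Nat.lt_or_ge (p₁ + j) (p₃ + 1) with hj2' | hj2
      · have := (hrun2 (p₁ + j) hj1 (by omega)).2; rw [hy1_p₂] at this; omega
      rcases Nat.lt_or_ge (p₁ + j) (r₁ + 1) with hj3' | hj3
      · have := (hrun3 (p₁ + j) hj2 (by omega)).2; rw [hy1_p₃] at this; omega
      rcases Nat.lt_or_ge (p₁ + j) (p₄ + 1) with hj4' | hj4
      · have := (hrun4 (p₁ + j) hj3 (by omega)).2; rw [hy1_r₁] at this; omega
      rcases Nat.lt_or_ge (p₁ + j) (r₂ + 1) with hj5' | hj5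
      · have := (hrun5 (p₁ + j) hj4 (by omega)).2; rw [hy1_p₄] at this; omega
      rcases Nat.lt_or_ge (p₁ + j) (r₃ + 1) with hj6' | hj6
      · have := (hrun6 (p₁ + j) hj5 (by omega)).2; rw [hy1_r₂] at this; omega
      · have := (hrun7 (p₁ + j) hj6 (by omega)).2; rw [hy1_r₃] at this; omega
    have hv3 : visits m ω = visits r₄ ω + visits (m - r₄) (fun _ => (0 : Site 2)) := by
      have := visits_add (a := r₄) (b := m - r₄) (ζ := ω) (ξ := fun _ => (0 : Site 2)) hsev (fun j hj1 hj2 => ?_)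
      · rwa [show r₄ + (m - r₄) = m by omega] at this
      rw [(hR8 (r₄ + j) (by omega) (by omega)).2]; rfl
    have hv4 : visits (m - r₄) (fun _ => (0 : Site 2)) = (m - r₄) / 2 := visits_eq_div_two_of_wall (fun i _ _ => rfl)
    rw [hv3, hv2, hv1, hv4]
  rw [hvf] at hv
  have hpodd : p₁ % 2 = 1 := by rw [hP1x, hP1y] at hpar_p₁; omega
  have hs_eq : r₄ + 2 * k + 1 = m + p₁ := wall_run_length_d4 hm hv hpodd hsev hn_r₄
  have hN' : ω m 0 + p₁ = ω r₄ 0 + 2 * k := by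
    rw [(hR8 m (by omega) le_rfl).1]; omega
  -- gaps between consecutive vertical steps
  have hgap1 : p₁ + 2 ≤ p₂ := by
    by_contra h
    obtain rfl : p₂ = p₁ + 1 := by omega
    rw [hx_p₂, hP1x] at hpar_p₂; rw [hy1_p₂] at hpar_p₂; omega
  have hgap2 : p₂ + 2 ≤ p₃ := by
    by_contra h
    obtain rfl : p₃ = p₂ + 1 := by omega
    rw [hx_p₃, hx_p₂] at hpar_p₃; rw [hy1_p₃] at hpar_p₃; rw [hx_p₂, hy1_p₂] at hpar_p₂; omega
  have hgap3 : p₃ + 2 ≤ r₁ := by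
    by_contra h
    obtain rfl : r₁ = p₃ + 1 := by omega
    have := hinj (hmem (p₃ + 1 + 1) (by omega)) (hmem p₃ (by omega))
      (site_ext_d4r (by rw [hx_r₁, hx_p₃]) (by rw [hy1_r₁, hy_p₃]))
    omega
  have hgap4 : r₁ + 2 ≤ p₄ := by
    by_contra h
    obtain rfl : p₄ = r₁ + 1 := by omega
    have := hinj (hmem (r₁ + 1 + 1) (by omega)) (hmem r₁ (by omega))
      (site_ext_d4r (by rw [hx_p₄, hx_r₁]) (by rw [hy1_p₄, hy_r₁]))
    omega
  have hgap5 : p₄ + 2 ≤ r₂ := by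
    by_contra h
    obtain rfl : r₂ = p₄ + 1 := by omega
    have := hinj (hmem (p₄ + 1 + 1) (by omega)) (hmem p₄ (by omega))
      (site_ext_d4r (by rw [hx_r₂, hx_p₄]) (by rw [hy1_r₂, hy_p₄]))
    omega
  refine ⟨e1, e2, e3, e4, e5, e6, e7, he1, he2, he3, he4, he5, he6, he7,
    fun i hi1 hi2 => ⟨by rw [(hrun1 i hi1 hi2).1, hP1x], by rw [(hrun1 i hi1 hi2).2, hP1y]⟩,
    fun i hi1 hi2 => ⟨by rw [(hrun2 i hi1 hi2).1, hx_p₂], by rw [(hrun2 i hi1 hi2).2, hy1_p₂]⟩,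
    fun i hi1 hi2 => ⟨by rw [(hrun3 i hi1 hi2).1, hx_p₃], by rw [(hrun3 i hi1 hi2).2, hy1_p₃]⟩,
    fun i hi1 hi2 => ⟨by rw [(hrun4 i hi1 hi2).1, hx_r₁], by rw [(hrun4 i hi1 hi2).2, hy1_r₁]⟩,
    fun i hi1 hi2 => ⟨by rw [(hrun5 i hi1 hi2).1, hx_p₄], by rw [(hrun5 i hi1 hi2).2, hy1_p₄]⟩,
    fun i hi1 hi2 => ⟨by rw [(hrun6 i hi1 hi2).1, hx_r₂], by rw [(hrun6 i hi1 hi2).2, hy1_r₂]⟩,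
    fun i hi1 hi2 => ⟨by rw [(hrun7 i hi1 hi2).1, hx_r₃], by rw [(hrun7 i hi1 hi2).2, hy1_r₃]⟩,
    hR8, hs_eq, hN', hparc_p₂, hparc_p₃, hparc_r₁, hparc_p₄, hparc_r₂, hparc_r₃, hparc_r₄,
    hpos_p₂, hpos_p₃, hpos_r₁, hpos_p₄, hpos_r₂, hpos_r₃, hgap1, hgap2, hgap3, hgap4, hgap5, hn_r₄⟩

/-- **Order `D D D U U D U U` at slack four: the seven body runs.**  For `m = 6k + 4`, `k` visits, four down times
`p₁ < p₂ < p₃ < p₄` and four up times `r₁ < r₂ < r₃ < r₄` interleaved in the order `D D D U U D U U`: between consecutive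
vertical steps the walk is a monotone run of sign `eⱼ ∈ {1, −1}` on the rows `−1, −2, −3, −2, −1, −2, −1`, the final run returns
rightwards along the wall, the visit count reads `r₄ + 2k + 1 = m + p₁` (so `X + p₁ = ω r₄ 0 + 2k`), the columns at
the vertical steps have the parities forced by the brick-wall frame, the interior ones are positive, and consecutive
vertical steps of types `D D` / `D U` / `U D` are `≥ 2` apart.  Analogue of `ddduuu4_runs` (`…SlackFourThreeDownRuns`),
same proof. OURS (routine tool). [cite: MadrasSlade1993, §4.2, Definition 4.2.1 (p. 90), (4.2.2)]
[cite: EntingJensen2009, §7.4.2, Fig. 7.10] -/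
theorem ddduuduu4_runs {k m : ℕ} (hm : m = 6 * k + 4) (hω : ω ∈ ipwb m) (hv : visits m ω = k)
    {p₁ p₂ p₃ p₄ r₁ r₂ r₃ r₄ : ℕ} (hD : stepsD m ω = {p₁, p₂, p₃, p₄}) (hU : stepsU m ω = {r₁, r₂, r₃, r₄})
    (h12 : p₁ < p₂) (h23 : p₂ < p₃) (h34 : p₃ < p₄) (hr12 : r₁ < r₂) (hr23 : r₂ < r₃) (hr34 : r₃ < r₄)
    (ht3 : p₃ < r₁) (ht5 : r₂ < p₄) (ht6 : p₄ < r₃) (hp1 : 1 ≤ p₁) (hR0 : ∀ i, i ≤ p₁ → ω i 0 = i ∧ ω i 1 = 0)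
    (hP1x : ω (p₁ + 1) 0 = p₁) (hP1y : ω (p₁ + 1) 1 = -1)
    (hhor : ∀ i, i < m → i ∉ stepsD m ω → i ∉ stepsU m ω →
      ω (i + 1) 1 = ω i 1 ∧ (ω (i + 1) 0 = ω i 0 + 1 ∨ ω (i + 1) 0 = ω i 0 - 1)) :
    ∃ e₁ e₂ e₃ e₄ e₅ e₆ e₇ : ℤ, (e₁ = 1 ∨ e₁ = -1) ∧ (e₂ = 1 ∨ e₂ = -1) ∧ (e₃ = 1 ∨ e₃ = -1) ∧ (e₄ = 1 ∨ e₄ = -1) ∧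
      (e₅ = 1 ∨ e₅ = -1) ∧ (e₆ = 1 ∨ e₆ = -1) ∧ (e₇ = 1 ∨ e₇ = -1) ∧
      (∀ i, p₁ + 1 ≤ i → i ≤ p₂ → ω i 0 = p₁ + e₁ * ((i - (p₁ + 1) : ℕ) : ℤ) ∧ ω i 1 = -1) ∧
      (∀ i, p₂ + 1 ≤ i → i ≤ p₃ → ω i 0 = ω p₂ 0 + e₂ * ((i - (p₂ + 1) : ℕ) : ℤ) ∧ ω i 1 = -2) ∧
      (∀ i, p₃ + 1 ≤ i → i ≤ r₁ → ω i 0 = ω p₃ 0 + e₃ * ((i - (p₃ + 1) : ℕ) : ℤ) ∧ ω i 1 = -3) ∧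
      (∀ i, r₁ + 1 ≤ i → i ≤ r₂ → ω i 0 = ω r₁ 0 + e₄ * ((i - (r₁ + 1) : ℕ) : ℤ) ∧ ω i 1 = -2) ∧
      (∀ i, r₂ + 1 ≤ i → i ≤ p₄ → ω i 0 = ω r₂ 0 + e₅ * ((i - (r₂ + 1) : ℕ) : ℤ) ∧ ω i 1 = -1) ∧
      (∀ i, p₄ + 1 ≤ i → i ≤ r₃ → ω i 0 = ω p₄ 0 + e₆ * ((i - (p₄ + 1) : ℕ) : ℤ) ∧ ω i 1 = -2) ∧
      (∀ i, r₃ + 1 ≤ i → i ≤ r₄ → ω i 0 = ω r₃ 0 + e₇ * ((i - (r₃ + 1) : ℕ) : ℤ) ∧ ω i 1 = -1) ∧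
      (∀ j, r₄ + 1 ≤ j → j ≤ m → ω j 0 = ω r₄ 0 + ((j - (r₄ + 1) : ℕ) : ℤ) ∧ ω j 1 = 0) ∧
      r₄ + 2 * k + 1 = m + p₁ ∧ ω m 0 + p₁ = ω r₄ 0 + 2 * k ∧
      ω p₂ 0 % 2 = 0 ∧ ω p₃ 0 % 2 = 1 ∧ ω r₁ 0 % 2 = 1 ∧ ω r₂ 0 % 2 = 0 ∧ ω p₄ 0 % 2 = 0 ∧ ω r₃ 0 % 2 = 0 ∧
      ω r₄ 0 % 2 = 1 ∧ 0 < ω p₂ 0 ∧ 0 < ω p₃ 0 ∧ 0 < ω r₁ 0 ∧ 0 < ω r₂ 0 ∧ 0 < ω p₄ 0 ∧ 0 < ω r₃ 0 ∧ p₁ + 2 ≤ p₂ ∧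
      p₂ + 2 ≤ p₃ ∧ p₃ + 2 ≤ r₁ ∧ r₂ + 2 ≤ p₄ ∧ p₄ + 2 ≤ r₃ ∧ r₄ < m := by
  classical
  obtain ⟨hpw, hn1, hirr⟩ := mem_ipwb.1 hω
  obtain ⟨hw, hb⟩ := mem_pwb.1 hpw
  obtain ⟨ha, -⟩ := mem_wbr.1 hw
  obtain ⟨hh, -, -⟩ := mem_archs.1 ha
  obtain ⟨hs, hhp⟩ := mem_hpw.1 hh
  obtain ⟨h0, -, hbw, hinj⟩ := mem_saws_iff.1 hs
  have hX0 : ω 0 0 = 0 := by rw [h0]; rfl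
  have hb' : ∀ i, 1 ≤ i → i ≤ m → 0 < ω i 0 ∧ ω i 0 ≤ ω m 0 := fun i h1 h2 => by
    have := hb i h1 h2; rwa [hX0] at this
  have hmem : ∀ i, i ≤ m → i ∈ {i | i ≤ m} := fun i hi => hi
  have hmD : ∀ i, i ∈ stepsD m ω ↔ i = p₁ ∨ i = p₂ ∨ i = p₃ ∨ i = p₄ := fun i => by
    rw [hD]; simp only [Finset.mem_insert, Finset.mem_singleton]
  have hmU : ∀ i, i ∈ stepsU m ω ↔ i = r₁ ∨ i = r₂ ∨ i = r₃ ∨ i = r₄ := fun i => by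
    rw [hU]; simp only [Finset.mem_insert, Finset.mem_singleton]
  obtain ⟨-, -, -, hpar_p₁⟩ := of_mem_stepsD_coord hbw (i := p₁) ((hmD _).2 (by simp))
  obtain ⟨hn_p₂, hx_p₂, hys_p₂, hpar_p₂⟩ := of_mem_stepsD_coord hbw (i := p₂) ((hmD _).2 (by simp))
  obtain ⟨hn_p₃, hx_p₃, hys_p₃, hpar_p₃⟩ := of_mem_stepsD_coord hbw (i := p₃) ((hmD _).2 (by simp))
  obtain ⟨hn_r₁, hx_r₁, hys_r₁, hpar_r₁⟩ := of_mem_stepsU_coord hbw (i := r₁) ((hmU _).2 (by simp))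
  obtain ⟨hn_r₂, hx_r₂, hys_r₂, hpar_r₂⟩ := of_mem_stepsU_coord hbw (i := r₂) ((hmU _).2 (by simp))
  obtain ⟨hn_p₄, hx_p₄, hys_p₄, hpar_p₄⟩ := of_mem_stepsD_coord hbw (i := p₄) ((hmD _).2 (by simp))
  obtain ⟨hn_r₃, hx_r₃, hys_r₃, hpar_r₃⟩ := of_mem_stepsU_coord hbw (i := r₃) ((hmU _).2 (by simp))
  obtain ⟨hn_r₄, hx_r₄, hys_r₄, hpar_r₄⟩ := of_mem_stepsU_coord hbw (i := r₄) ((hmU _).2 (by simp))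
  have hhor' : ∀ i, i < m → i ≠ p₁ → i ≠ p₂ → i ≠ p₃ → i ≠ p₄ → i ≠ r₁ → i ≠ r₂ → i ≠ r₃ → i ≠ r₄ →
      ω (i + 1) 1 = ω i 1 ∧ (ω (i + 1) 0 = ω i 0 + 1 ∨ ω (i + 1) 0 = ω i 0 - 1) :=
    fun i hi n1 n2 n3 n4 n5 n6 n7 n8 => hhor i hi (by rw [hmD]; omega) (by rw [hmU]; omega)
  -- run 1 on row `−1`
  obtain ⟨e1, he1, hrun1⟩ := run_const_velocity hinj (a := p₁ + 1) (b := p₂) (by omega) (by omega)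
    (fun i hi1 hi2 => hhor' i (by omega) (by omega) (by omega) (by omega) (by omega) (by omega) (by omega) (by omega) (by omega))
  have hy_p₂ : ω p₂ 1 = -1 := by rw [(hrun1 p₂ (by omega) le_rfl).2, hP1y]
  have hy1_p₂ : ω (p₂ + 1) 1 = -2 := by rw [hys_p₂, hy_p₂]; rfl
  have hparc_p₂ : ω p₂ 0 % 2 = 0 := by rw [hx_p₂, hy1_p₂] at hpar_p₂; omega
  have hpos_p₂ := (hb' p₂ (by omega) (by omega)).1
  -- run 2 on row `−2`
  obtain ⟨e2, he2, hrun2⟩ := run_const_velocity hinj (a := p₂ + 1) (b := p₃) (by omega) (by omega)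
    (fun i hi1 hi2 => hhor' i (by omega) (by omega) (by omega) (by omega) (by omega) (by omega) (by omega) (by omega) (by omega))
  have hy_p₃ : ω p₃ 1 = -2 := by rw [(hrun2 p₃ (by omega) le_rfl).2, hy1_p₂]
  have hy1_p₃ : ω (p₃ + 1) 1 = -3 := by rw [hys_p₃, hy_p₃]; rfl
  have hparc_p₃ : ω p₃ 0 % 2 = 1 := by rw [hx_p₃, hy1_p₃] at hpar_p₃; omega
  have hpos_p₃ := (hb' p₃ (by omega) (by omega)).1
  -- run 3 on row `−3`
  obtain ⟨e3, he3, hrun3⟩ := run_const_velocity hinj (a := p₃ + 1) (b := r₁) (by omega) (by omega)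
    (fun i hi1 hi2 => hhor' i (by omega) (by omega) (by omega) (by omega) (by omega) (by omega) (by omega) (by omega) (by omega))
  have hy_r₁ : ω r₁ 1 = -3 := by rw [(hrun3 r₁ (by omega) le_rfl).2, hy1_p₃]
  have hy1_r₁ : ω (r₁ + 1) 1 = -2 := by rw [hys_r₁, hy_r₁]; rfl
  have hparc_r₁ : ω r₁ 0 % 2 = 1 := by rw [hy_r₁] at hpar_r₁; omega
  have hpos_r₁ := (hb' r₁ (by omega) (by omega)).1
  -- run 4 on row `−2`
  obtain ⟨e4, he4, hrun4⟩ := run_const_velocity hinj (a := r₁ + 1) (b := r₂) (by omega) (by omega)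
    (fun i hi1 hi2 => hhor' i (by omega) (by omega) (by omega) (by omega) (by omega) (by omega) (by omega) (by omega) (by omega))
  have hy_r₂ : ω r₂ 1 = -2 := by rw [(hrun4 r₂ (by omega) le_rfl).2, hy1_r₁]
  have hy1_r₂ : ω (r₂ + 1) 1 = -1 := by rw [hys_r₂, hy_r₂]; rfl
  have hparc_r₂ : ω r₂ 0 % 2 = 0 := by rw [hy_r₂] at hpar_r₂; omega
  have hpos_r₂ := (hb' r₂ (by omega) (by omega)).1
  -- run 5 on row `−1`
  obtain ⟨e5, he5, hrun5⟩ := run_const_velocity hinj (a := r₂ + 1) (b := p₄) (by omega) (by omega)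
    (fun i hi1 hi2 => hhor' i (by omega) (by omega) (by omega) (by omega) (by omega) (by omega) (by omega) (by omega) (by omega))
  have hy_p₄ : ω p₄ 1 = -1 := by rw [(hrun5 p₄ (by omega) le_rfl).2, hy1_r₂]
  have hy1_p₄ : ω (p₄ + 1) 1 = -2 := by rw [hys_p₄, hy_p₄]; rfl
  have hparc_p₄ : ω p₄ 0 % 2 = 0 := by rw [hx_p₄, hy1_p₄] at hpar_p₄; omega
  have hpos_p₄ := (hb' p₄ (by omega) (by omega)).1
  -- run 6 on row `−2`
  obtain ⟨e6, he6, hrun6⟩ := run_const_velocity hinj (a := p₄ + 1) (b := r₃) (by omega) (by omega)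
    (fun i hi1 hi2 => hhor' i (by omega) (by omega) (by omega) (by omega) (by omega) (by omega) (by omega) (by omega) (by omega))
  have hy_r₃ : ω r₃ 1 = -2 := by rw [(hrun6 r₃ (by omega) le_rfl).2, hy1_p₄]
  have hy1_r₃ : ω (r₃ + 1) 1 = -1 := by rw [hys_r₃, hy_r₃]; rfl
  have hparc_r₃ : ω r₃ 0 % 2 = 0 := by rw [hy_r₃] at hpar_r₃; omega
  have hpos_r₃ := (hb' r₃ (by omega) (by omega)).1
  -- run 7 on row `−1`
  obtain ⟨e7, he7, hrun7⟩ := run_const_velocity hinj (a := r₃ + 1) (b := r₄) (by omega) (by omega)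
    (fun i hi1 hi2 => hhor' i (by omega) (by omega) (by omega) (by omega) (by omega) (by omega) (by omega) (by omega) (by omega))
  have hy_r₄ : ω r₄ 1 = -1 := by rw [(hrun7 r₄ (by omega) le_rfl).2, hy1_r₃]
  have hy1_r₄ : ω (r₄ + 1) 1 = 0 := by rw [hys_r₄, hy_r₄]; rfl
  have hparc_r₄ : ω r₄ 0 % 2 = 1 := by rw [hy_r₄] at hpar_r₄; omega
  have hsev : r₄ % 2 = 0 := by have := parity_apply hs (show r₄ ≤ m by omega); rw [hy_r₄] at this; omega
  -- run 8 on the wall goes right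
  obtain ⟨e8, he8, hrun8⟩ := run_const_velocity hinj (a := r₄ + 1) (b := m) (by omega) le_rfl
    (fun i hi1 hi2 => hhor' i (by omega) (by omega) (by omega) (by omega) (by omega) (by omega) (by omega) (by omega)
      (by omega))
  obtain rfl : e8 = 1 := by
    rcases he8 with h | rfl
    · exact h
    exfalso
    have hN := (hrun8 m (by omega) le_rfl).1
    have hbn := (hb' (r₄ + 1) (by omega) (by omega)).2
    rw [hx_r₄] at hN hbn
    omega
  have hR8 : ∀ j, r₄ + 1 ≤ j → j ≤ m → ω j 0 = ω r₄ 0 + ((j - (r₄ + 1) : ℕ) : ℤ) ∧ ω j 1 = 0 := fun j hj1 hj2 => by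
    obtain ⟨hx, hy⟩ := hrun8 j hj1 hj2
    rw [hx_r₄] at hx; rw [hy1_r₄] at hy
    exact ⟨by rw [hx]; ring, hy⟩
  -- the visit count
  have hvf : visits m ω = p₁ / 2 + (m - r₄) / 2 := by
    have hv1 : visits p₁ ω = p₁ / 2 := visits_eq_div_two_of_wall (fun i _ hi2 => (hR0 i hi2).2)
    have hv2 : visits r₄ ω = visits p₁ ω := by
      have := visits_add_eq_left (k := p₁) (b := r₄ - p₁) (ζ := ω) (fun j hj1 hj2 => ?_)
      · rwa [show p₁ + (r₄ - p₁) = r₄ by omega] at this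
      rintro ⟨-, hy⟩
      rcases Nat.lt_or_ge (p₁ + j) (p₂ + 1) with hj1' | hj1
      · have := (hrun1 (p₁ + j) (by omega) (by omega)).2; rw [hP1y] at this; omega
      rcases Nat.lt_or_ge (p₁ + j) (p₃ + 1) with hj2' | hj2
      · have := (hrun2 (p₁ + j) hj1 (by omega)).2; rw [hy1_p₂] at this; omega
      rcases Nat.lt_or_ge (p₁ + j) (r₁ + 1) with hj3' | hj3
      · have := (hrun3 (p₁ + j) hj2 (by omega)).2; rw [hy1_p₃] at this; omega
      rcases Nat.lt_or_ge (p₁ + j) (r₂ + 1) with hj4' | hj4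
      · have := (hrun4 (p₁ + j) hj3 (by omega)).2; rw [hy1_r₁] at this; omega
      rcases Nat.lt_or_ge (p₁ + j) (p₄ + 1) with hj5' | hj5
      · have := (hrun5 (p₁ + j) hj4 (by omega)).2; rw [hy1_r₂] at this; omega
      rcases Nat.lt_or_ge (p₁ + j) (r₃ + 1) with hj6' | hj6
      · have := (hrun6 (p₁ + j) hj5 (by omega)).2; rw [hy1_p₄] at this; omega
      · have := (hrun7 (p₁ + j) hj6 (by omega)).2; rw [hy1_r₃] at this; omega
    have hv3 : visits m ω = visits r₄ ω + visits (m - r₄) (fun _ => (0 : Site 2)) := by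
      have := visits_add (a := r₄) (b := m - r₄) (ζ := ω) (ξ := fun _ => (0 : Site 2)) hsev (fun j hj1 hj2 => ?_)
      · rwa [show r₄ + (m - r₄) = m by omega] at this
      rw [(hR8 (r₄ + j) (by omega) (by omega)).2]; rfl
    have hv4 : visits (m - r₄) (fun _ => (0 : Site 2)) = (m - r₄) / 2 := visits_eq_div_two_of_wall (fun i _ _ => rfl)
    rw [hv3, hv2, hv1, hv4]
  rw [hvf] at hv
  have hpodd : p₁ % 2 = 1 := by rw [hP1x, hP1y] at hpar_p₁; omega
  have hs_eq : r₄ + 2 * k + 1 = m + p₁ := wall_run_length_d4 hm hv hpodd hsev hn_r₄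
  have hN' : ω m 0 + p₁ = ω r₄ 0 + 2 * k := by
    rw [(hR8 m (by omega) le_rfl).1]; omega
  -- gaps between consecutive vertical steps
  have hgap1 : p₁ + 2 ≤ p₂ := by
    by_contra h
    obtain rfl : p₂ = p₁ + 1 := by omega
    rw [hx_p₂, hP1x] at hpar_p₂; rw [hy1_p₂] at hpar_p₂; omega
  have hgap2 : p₂ + 2 ≤ p₃ := by
    by_contra h
    obtain rfl : p₃ = p₂ + 1 := by omega
    rw [hx_p₃, hx_p₂] at hpar_p₃; rw [hy1_p₃] at hpar_p₃; rw [hx_p₂, hy1_p₂] at hpar_p₂; omega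
  have hgap3 : p₃ + 2 ≤ r₁ := by
    by_contra h
    obtain rfl : r₁ = p₃ + 1 := by omega
    have := hinj (hmem (p₃ + 1 + 1) (by omega)) (hmem p₃ (by omega))
      (site_ext_d4r (by rw [hx_r₁, hx_p₃]) (by rw [hy1_r₁, hy_p₃]))
    omega
  have hgap5 : r₂ + 2 ≤ p₄ := by
    by_contra h
    obtain rfl : p₄ = r₂ + 1 := by omega
    have := hinj (hmem (r₂ + 1 + 1) (by omega)) (hmem r₂ (by omega))
      (site_ext_d4r (by rw [hx_p₄, hx_r₂]) (by rw [hy1_p₄, hy_r₂]))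
    omega
  have hgap6 : p₄ + 2 ≤ r₃ := by
    by_contra h
    obtain rfl : r₃ = p₄ + 1 := by omega
    have := hinj (hmem (p₄ + 1 + 1) (by omega)) (hmem p₄ (by omega))
      (site_ext_d4r (by rw [hx_r₃, hx_p₄]) (by rw [hy1_r₃, hy_p₄]))
    omega
  refine ⟨e1, e2, e3, e4, e5, e6, e7, he1, he2, he3, he4, he5, he6, he7,
    fun i hi1 hi2 => ⟨by rw [(hrun1 i hi1 hi2).1, hP1x], by rw [(hrun1 i hi1 hi2).2, hP1y]⟩,
    fun i hi1 hi2 => ⟨by rw [(hrun2 i hi1 hi2).1, hx_p₂], by rw [(hrun2 i hi1 hi2).2, hy1_p₂]⟩,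
    fun i hi1 hi2 => ⟨by rw [(hrun3 i hi1 hi2).1, hx_p₃], by rw [(hrun3 i hi1 hi2).2, hy1_p₃]⟩,
    fun i hi1 hi2 => ⟨by rw [(hrun4 i hi1 hi2).1, hx_r₁], by rw [(hrun4 i hi1 hi2).2, hy1_r₁]⟩,
    fun i hi1 hi2 => ⟨by rw [(hrun5 i hi1 hi2).1, hx_r₂], by rw [(hrun5 i hi1 hi2).2, hy1_r₂]⟩,
    fun i hi1 hi2 => ⟨by rw [(hrun6 i hi1 hi2).1, hx_p₄], by rw [(hrun6 i hi1 hi2).2, hy1_p₄]⟩,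
    fun i hi1 hi2 => ⟨by rw [(hrun7 i hi1 hi2).1, hx_r₃], by rw [(hrun7 i hi1 hi2).2, hy1_r₃]⟩,
    hR8, hs_eq, hN', hparc_p₂, hparc_p₃, hparc_r₁, hparc_r₂, hparc_p₄, hparc_r₃, hparc_r₄,
    hpos_p₂, hpos_p₃, hpos_r₁, hpos_r₂, hpos_p₄, hpos_r₃, hgap1, hgap2, hgap3, hgap5, hgap6, hn_r₄⟩

/-- **Order `D D U D D U U U` at slack four: the seven body runs.**  For `m = 6k + 4`, `k` visits, four down times
`p₁ < p₂ < p₃ < p₄` and four up times `r₁ < r₂ < r₃ < r₄` interleaved in the order `D D U D D U U U`: between consecutive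
vertical steps the walk is a monotone run of sign `eⱼ ∈ {1, −1}` on the rows `−1, −2, −1, −2, −3, −2, −1`, the final run returns
rightwards along the wall, the visit count reads `r₄ + 2k + 1 = m + p₁` (so `X + p₁ = ω r₄ 0 + 2k`), the columns at
the vertical steps have the parities forced by the brick-wall frame, the interior ones are positive, and consecutive
vertical steps of types `D D` / `D U` / `U D` are `≥ 2` apart.  Analogue of `ddduuu4_runs` (`…SlackFourThreeDownRuns`),
same proof. OURS (routine tool). [cite: MadrasSlade1993, §4.2, Definition 4.2.1 (p. 90), (4.2.2)]
[cite: EntingJensen2009, §7.4.2, Fig. 7.10] -/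
theorem ddudduuu4_runs {k m : ℕ} (hm : m = 6 * k + 4) (hω : ω ∈ ipwb m) (hv : visits m ω = k)
    {p₁ p₂ p₃ p₄ r₁ r₂ r₃ r₄ : ℕ} (hD : stepsD m ω = {p₁, p₂, p₃, p₄}) (hU : stepsU m ω = {r₁, r₂, r₃, r₄})
    (h12 : p₁ < p₂) (h23 : p₂ < p₃) (h34 : p₃ < p₄) (hr12 : r₁ < r₂) (hr23 : r₂ < r₃) (hr34 : r₃ < r₄)
    (ht2 : p₂ < r₁) (ht3 : r₁ < p₃) (ht5 : p₄ < r₂) (hp1 : 1 ≤ p₁) (hR0 : ∀ i, i ≤ p₁ → ω i 0 = i ∧ ω i 1 = 0)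
    (hP1x : ω (p₁ + 1) 0 = p₁) (hP1y : ω (p₁ + 1) 1 = -1)
    (hhor : ∀ i, i < m → i ∉ stepsD m ω → i ∉ stepsU m ω →
      ω (i + 1) 1 = ω i 1 ∧ (ω (i + 1) 0 = ω i 0 + 1 ∨ ω (i + 1) 0 = ω i 0 - 1)) :
    ∃ e₁ e₂ e₃ e₄ e₅ e₆ e₇ : ℤ, (e₁ = 1 ∨ e₁ = -1) ∧ (e₂ = 1 ∨ e₂ = -1) ∧ (e₃ = 1 ∨ e₃ = -1) ∧ (e₄ = 1 ∨ e₄ = -1) ∧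
      (e₅ = 1 ∨ e₅ = -1) ∧ (e₆ = 1 ∨ e₆ = -1) ∧ (e₇ = 1 ∨ e₇ = -1) ∧
      (∀ i, p₁ + 1 ≤ i → i ≤ p₂ → ω i 0 = p₁ + e₁ * ((i - (p₁ + 1) : ℕ) : ℤ) ∧ ω i 1 = -1) ∧
      (∀ i, p₂ + 1 ≤ i → i ≤ r₁ → ω i 0 = ω p₂ 0 + e₂ * ((i - (p₂ + 1) : ℕ) : ℤ) ∧ ω i 1 = -2) ∧
      (∀ i, r₁ + 1 ≤ i → i ≤ p₃ → ω i 0 = ω r₁ 0 + e₃ * ((i - (r₁ + 1) : ℕ) : ℤ) ∧ ω i 1 = -1) ∧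
      (∀ i, p₃ + 1 ≤ i → i ≤ p₄ → ω i 0 = ω p₃ 0 + e₄ * ((i - (p₃ + 1) : ℕ) : ℤ) ∧ ω i 1 = -2) ∧
      (∀ i, p₄ + 1 ≤ i → i ≤ r₂ → ω i 0 = ω p₄ 0 + e₅ * ((i - (p₄ + 1) : ℕ) : ℤ) ∧ ω i 1 = -3) ∧
      (∀ i, r₂ + 1 ≤ i → i ≤ r₃ → ω i 0 = ω r₂ 0 + e₆ * ((i - (r₂ + 1) : ℕ) : ℤ) ∧ ω i 1 = -2) ∧
      (∀ i, r₃ + 1 ≤ i → i ≤ r₄ → ω i 0 = ω r₃ 0 + e₇ * ((i - (r₃ + 1) : ℕ) : ℤ) ∧ ω i 1 = -1) ∧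
      (∀ j, r₄ + 1 ≤ j → j ≤ m → ω j 0 = ω r₄ 0 + ((j - (r₄ + 1) : ℕ) : ℤ) ∧ ω j 1 = 0) ∧
      r₄ + 2 * k + 1 = m + p₁ ∧ ω m 0 + p₁ = ω r₄ 0 + 2 * k ∧
      ω p₂ 0 % 2 = 0 ∧ ω r₁ 0 % 2 = 0 ∧ ω p₃ 0 % 2 = 0 ∧ ω p₄ 0 % 2 = 1 ∧ ω r₂ 0 % 2 = 1 ∧ ω r₃ 0 % 2 = 0 ∧
      ω r₄ 0 % 2 = 1 ∧ 0 < ω p₂ 0 ∧ 0 < ω r₁ 0 ∧ 0 < ω p₃ 0 ∧ 0 < ω p₄ 0 ∧ 0 < ω r₂ 0 ∧ 0 < ω r₃ 0 ∧ p₁ + 2 ≤ p₂ ∧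
      p₂ + 2 ≤ r₁ ∧ r₁ + 2 ≤ p₃ ∧ p₃ + 2 ≤ p₄ ∧ p₄ + 2 ≤ r₂ ∧ r₄ < m := by
  classical
  obtain ⟨hpw, hn1, hirr⟩ := mem_ipwb.1 hω
  obtain ⟨hw, hb⟩ := mem_pwb.1 hpw
  obtain ⟨ha, -⟩ := mem_wbr.1 hw
  obtain ⟨hh, -, -⟩ := mem_archs.1 ha
  obtain ⟨hs, hhp⟩ := mem_hpw.1 hh
  obtain ⟨h0, -, hbw, hinj⟩ := mem_saws_iff.1 hs
  have hX0 : ω 0 0 = 0 := by rw [h0]; rfl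
  have hb' : ∀ i, 1 ≤ i → i ≤ m → 0 < ω i 0 ∧ ω i 0 ≤ ω m 0 := fun i h1 h2 => by
    have := hb i h1 h2; rwa [hX0] at this
  have hmem : ∀ i, i ≤ m → i ∈ {i | i ≤ m} := fun i hi => hi
  have hmD : ∀ i, i ∈ stepsD m ω ↔ i = p₁ ∨ i = p₂ ∨ i = p₃ ∨ i = p₄ := fun i => by
    rw [hD]; simp only [Finset.mem_insert, Finset.mem_singleton]
  have hmU : ∀ i, i ∈ stepsU m ω ↔ i = r₁ ∨ i = r₂ ∨ i = r₃ ∨ i = r₄ := fun i => by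
    rw [hU]; simp only [Finset.mem_insert, Finset.mem_singleton]
  obtain ⟨-, -, -, hpar_p₁⟩ := of_mem_stepsD_coord hbw (i := p₁) ((hmD _).2 (by simp))
  obtain ⟨hn_p₂, hx_p₂, hys_p₂, hpar_p₂⟩ := of_mem_stepsD_coord hbw (i := p₂) ((hmD _).2 (by simp))
  obtain ⟨hn_r₁, hx_r₁, hys_r₁, hpar_r₁⟩ := of_mem_stepsU_coord hbw (i := r₁) ((hmU _).2 (by simp))
  obtain ⟨hn_p₃, hx_p₃, hys_p₃, hpar_p₃⟩ := of_mem_stepsD_coord hbw (i := p₃) ((hmD _).2 (by simp))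
  obtain ⟨hn_p₄, hx_p₄, hys_p₄, hpar_p₄⟩ := of_mem_stepsD_coord hbw (i := p₄) ((hmD _).2 (by simp))
  obtain ⟨hn_r₂, hx_r₂, hys_r₂, hpar_r₂⟩ := of_mem_stepsU_coord hbw (i := r₂) ((hmU _).2 (by simp))
  obtain ⟨hn_r₃, hx_r₃, hys_r₃, hpar_r₃⟩ := of_mem_stepsU_coord hbw (i := r₃) ((hmU _).2 (by simp))
  obtain ⟨hn_r₄, hx_r₄, hys_r₄, hpar_r₄⟩ := of_mem_stepsU_coord hbw (i := r₄) ((hmU _).2 (by simp))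
  have hhor' : ∀ i, i < m → i ≠ p₁ → i ≠ p₂ → i ≠ p₃ → i ≠ p₄ → i ≠ r₁ → i ≠ r₂ → i ≠ r₃ → i ≠ r₄ →
      ω (i + 1) 1 = ω i 1 ∧ (ω (i + 1) 0 = ω i 0 + 1 ∨ ω (i + 1) 0 = ω i 0 - 1) :=
    fun i hi n1 n2 n3 n4 n5 n6 n7 n8 => hhor i hi (by rw [hmD]; omega) (by rw [hmU]; omega)
  -- run 1 on row `−1`
  obtain ⟨e1, he1, hrun1⟩ := run_const_velocity hinj (a := p₁ + 1) (b := p₂) (by omega) (by omega)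
    (fun i hi1 hi2 => hhor' i (by omega) (by omega) (by omega) (by omega) (by omega) (by omega) (by omega) (by omega) (by omega))
  have hy_p₂ : ω p₂ 1 = -1 := by rw [(hrun1 p₂ (by omega) le_rfl).2, hP1y]
  have hy1_p₂ : ω (p₂ + 1) 1 = -2 := by rw [hys_p₂, hy_p₂]; rfl
  have hparc_p₂ : ω p₂ 0 % 2 = 0 := by rw [hx_p₂, hy1_p₂] at hpar_p₂; omega
  have hpos_p₂ := (hb' p₂ (by omega) (by omega)).1
  -- run 2 on row `−2`
  obtain ⟨e2, he2, hrun2⟩ := run_const_velocity hinj (a := p₂ + 1) (b := r₁) (by omega) (by omega)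
    (fun i hi1 hi2 => hhor' i (by omega) (by omega) (by omega) (by omega) (by omega) (by omega) (by omega) (by omega) (by omega))
  have hy_r₁ : ω r₁ 1 = -2 := by rw [(hrun2 r₁ (by omega) le_rfl).2, hy1_p₂]
  have hy1_r₁ : ω (r₁ + 1) 1 = -1 := by rw [hys_r₁, hy_r₁]; rfl
  have hparc_r₁ : ω r₁ 0 % 2 = 0 := by rw [hy_r₁] at hpar_r₁; omega
  have hpos_r₁ := (hb' r₁ (by omega) (by omega)).1
  -- run 3 on row `−1`
  obtain ⟨e3, he3, hrun3⟩ := run_const_velocity hinj (a := r₁ + 1) (b := p₃) (by omega) (by omega)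
    (fun i hi1 hi2 => hhor' i (by omega) (by omega) (by omega) (by omega) (by omega) (by omega) (by omega) (by omega) (by omega))
  have hy_p₃ : ω p₃ 1 = -1 := by rw [(hrun3 p₃ (by omega) le_rfl).2, hy1_r₁]
  have hy1_p₃ : ω (p₃ + 1) 1 = -2 := by rw [hys_p₃, hy_p₃]; rfl
  have hparc_p₃ : ω p₃ 0 % 2 = 0 := by rw [hx_p₃, hy1_p₃] at hpar_p₃; omega
  have hpos_p₃ := (hb' p₃ (by omega) (by omega)).1
  -- run 4 on row `−2`
  obtain ⟨e4, he4, hrun4⟩ := run_const_velocity hinj (a := p₃ + 1) (b := p₄) (by omega) (by omega)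
    (fun i hi1 hi2 => hhor' i (by omega) (by omega) (by omega) (by omega) (by omega) (by omega) (by omega) (by omega) (by omega))
  have hy_p₄ : ω p₄ 1 = -2 := by rw [(hrun4 p₄ (by omega) le_rfl).2, hy1_p₃]
  have hy1_p₄ : ω (p₄ + 1) 1 = -3 := by rw [hys_p₄, hy_p₄]; rfl
  have hparc_p₄ : ω p₄ 0 % 2 = 1 := by rw [hx_p₄, hy1_p₄] at hpar_p₄; omega
  have hpos_p₄ := (hb' p₄ (by omega) (by omega)).1
  -- run 5 on row `−3`
  obtain ⟨e5, he5, hrun5⟩ := run_const_velocity hinj (a := p₄ + 1) (b := r₂) (by omega) (by omega)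
    (fun i hi1 hi2 => hhor' i (by omega) (by omega) (by omega) (by omega) (by omega) (by omega) (by omega) (by omega) (by omega))
  have hy_r₂ : ω r₂ 1 = -3 := by rw [(hrun5 r₂ (by omega) le_rfl).2, hy1_p₄]
  have hy1_r₂ : ω (r₂ + 1) 1 = -2 := by rw [hys_r₂, hy_r₂]; rfl
  have hparc_r₂ : ω r₂ 0 % 2 = 1 := by rw [hy_r₂] at hpar_r₂; omega
  have hpos_r₂ := (hb' r₂ (by omega) (by omega)).1
  -- run 6 on row `−2`
  obtain ⟨e6, he6, hrun6⟩ := run_const_velocity hinj (a := r₂ + 1) (b := r₃) (by omega) (by omega)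
    (fun i hi1 hi2 => hhor' i (by omega) (by omega) (by omega) (by omega) (by omega) (by omega) (by omega) (by omega) (by omega))
  have hy_r₃ : ω r₃ 1 = -2 := by rw [(hrun6 r₃ (by omega) le_rfl).2, hy1_r₂]
  have hy1_r₃ : ω (r₃ + 1) 1 = -1 := by rw [hys_r₃, hy_r₃]; rfl
  have hparc_r₃ : ω r₃ 0 % 2 = 0 := by rw [hy_r₃] at hpar_r₃; omega
  have hpos_r₃ := (hb' r₃ (by omega) (by omega)).1
  -- run 7 on row `−1`
  obtain ⟨e7, he7, hrun7⟩ := run_const_velocity hinj (a := r₃ + 1) (b := r₄) (by omega) (by omega)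
    (fun i hi1 hi2 => hhor' i (by omega) (by omega) (by omega) (by omega) (by omega) (by omega) (by omega) (by omega) (by omega))
  have hy_r₄ : ω r₄ 1 = -1 := by rw [(hrun7 r₄ (by omega) le_rfl).2, hy1_r₃]
  have hy1_r₄ : ω (r₄ + 1) 1 = 0 := by rw [hys_r₄, hy_r₄]; rfl
  have hparc_r₄ : ω r₄ 0 % 2 = 1 := by rw [hy_r₄] at hpar_r₄; omega
  have hsev : r₄ % 2 = 0 := by have := parity_apply hs (show r₄ ≤ m by omega); rw [hy_r₄] at this; omega
  -- run 8 on the wall goes right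
  obtain ⟨e8, he8, hrun8⟩ := run_const_velocity hinj (a := r₄ + 1) (b := m) (by omega) le_rfl
    (fun i hi1 hi2 => hhor' i (by omega) (by omega) (by omega) (by omega) (by omega) (by omega) (by omega) (by omega)
      (by omega))
  obtain rfl : e8 = 1 := by
    rcases he8 with h | rfl
    · exact h
    exfalso
    have hN := (hrun8 m (by omega) le_rfl).1
    have hbn := (hb' (r₄ + 1) (by omega) (by omega)).2
    rw [hx_r₄] at hN hbn
    omega
  have hR8 : ∀ j, r₄ + 1 ≤ j → j ≤ m → ω j 0 = ω r₄ 0 + ((j - (r₄ + 1) : ℕ) : ℤ) ∧ ω j 1 = 0 := fun j hj1 hj2 => by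
    obtain ⟨hx, hy⟩ := hrun8 j hj1 hj2
    rw [hx_r₄] at hx; rw [hy1_r₄] at hy
    exact ⟨by rw [hx]; ring, hy⟩
  -- the visit count
  have hvf : visits m ω = p₁ / 2 + (m - r₄) / 2 := by
    have hv1 : visits p₁ ω = p₁ / 2 := visits_eq_div_two_of_wall (fun i _ hi2 => (hR0 i hi2).2)
    have hv2 : visits r₄ ω = visits p₁ ω := by
      have := visits_add_eq_left (k := p₁) (b := r₄ - p₁) (ζ := ω) (fun j hj1 hj2 => ?_)
      · rwa [show p₁ + (r₄ - p₁) = r₄ by omega] at this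
      rintro ⟨-, hy⟩
      rcases Nat.lt_or_ge (p₁ + j) (p₂ + 1) with hj1' | hj1
      · have := (hrun1 (p₁ + j) (by omega) (by omega)).2; rw [hP1y] at this; omega
      rcases Nat.lt_or_ge (p₁ + j) (r₁ + 1) with hj2' | hj2
      · have := (hrun2 (p₁ + j) hj1 (by omega)).2; rw [hy1_p₂] at this; omega
      rcases Nat.lt_or_ge (p₁ + j) (p₃ + 1) with hj3' | hj3
      · have := (hrun3 (p₁ + j) hj2 (by omega)).2; rw [hy1_r₁] at this; omega
      rcases Nat.lt_or_ge (p₁ + j) (p₄ + 1) with hj4' | hj4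
      · have := (hrun4 (p₁ + j) hj3 (by omega)).2; rw [hy1_p₃] at this; omega
      rcases Nat.lt_or_ge (p₁ + j) (r₂ + 1) with hj5' | hj5
      · have := (hrun5 (p₁ + j) hj4 (by omega)).2; rw [hy1_p₄] at this; omega
      rcases Nat.lt_or_ge (p₁ + j) (r₃ + 1) with hj6' | hj6
      · have := (hrun6 (p₁ + j) hj5 (by omega)).2; rw [hy1_r₂] at this; omega
      · have := (hrun7 (p₁ + j) hj6 (by omega)).2; rw [hy1_r₃] at this; omega
    have hv3 : visits m ω = visits r₄ ω + visits (m - r₄) (fun _ => (0 : Site 2)) := by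
      have := visits_add (a := r₄) (b := m - r₄) (ζ := ω) (ξ := fun _ => (0 : Site 2)) hsev (fun j hj1 hj2 => ?_)
      · rwa [show r₄ + (m - r₄) = m by omega] at this
      rw [(hR8 (r₄ + j) (by omega) (by omega)).2]; rfl
    have hv4 : visits (m - r₄) (fun _ => (0 : Site 2)) = (m - r₄) / 2 := visits_eq_div_two_of_wall (fun i _ _ => rfl)
    rw [hv3, hv2, hv1, hv4]
  rw [hvf] at hv
  have hpodd : p₁ % 2 = 1 := by rw [hP1x, hP1y] at hpar_p₁; omega
  have hs_eq : r₄ + 2 * k + 1 = m + p₁ := wall_run_length_d4 hm hv hpodd hsev hn_r₄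
  have hN' : ω m 0 + p₁ = ω r₄ 0 + 2 * k := by
    rw [(hR8 m (by omega) le_rfl).1]; omega
  -- gaps between consecutive vertical steps
  have hgap1 : p₁ + 2 ≤ p₂ := by
    by_contra h
    obtain rfl : p₂ = p₁ + 1 := by omega
    rw [hx_p₂, hP1x] at hpar_p₂; rw [hy1_p₂] at hpar_p₂; omega
  have hgap2 : p₂ + 2 ≤ r₁ := by
    by_contra h
    obtain rfl : r₁ = p₂ + 1 := by omega
    have := hinj (hmem (p₂ + 1 + 1) (by omega)) (hmem p₂ (by omega))
      (site_ext_d4r (by rw [hx_r₁, hx_p₂]) (by rw [hy1_r₁, hy_p₂]))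
    omega
  have hgap3 : r₁ + 2 ≤ p₃ := by
    by_contra h
    obtain rfl : p₃ = r₁ + 1 := by omega
    have := hinj (hmem (r₁ + 1 + 1) (by omega)) (hmem r₁ (by omega))
      (site_ext_d4r (by rw [hx_p₃, hx_r₁]) (by rw [hy1_p₃, hy_r₁]))
    omega
  have hgap4 : p₃ + 2 ≤ p₄ := by
    by_contra h
    obtain rfl : p₄ = p₃ + 1 := by omega
    rw [hx_p₄, hx_p₃] at hpar_p₄; rw [hy1_p₄] at hpar_p₄; rw [hx_p₃, hy1_p₃] at hpar_p₃; omega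
  have hgap5 : p₄ + 2 ≤ r₂ := by
    by_contra h
    obtain rfl : r₂ = p₄ + 1 := by omega
    have := hinj (hmem (p₄ + 1 + 1) (by omega)) (hmem p₄ (by omega))
      (site_ext_d4r (by rw [hx_r₂, hx_p₄]) (by rw [hy1_r₂, hy_p₄]))
    omega
  refine ⟨e1, e2, e3, e4, e5, e6, e7, he1, he2, he3, he4, he5, he6, he7,
    fun i hi1 hi2 => ⟨by rw [(hrun1 i hi1 hi2).1, hP1x], by rw [(hrun1 i hi1 hi2).2, hP1y]⟩,
    fun i hi1 hi2 => ⟨by rw [(hrun2 i hi1 hi2).1, hx_p₂], by rw [(hrun2 i hi1 hi2).2, hy1_p₂]⟩,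
    fun i hi1 hi2 => ⟨by rw [(hrun3 i hi1 hi2).1, hx_r₁], by rw [(hrun3 i hi1 hi2).2, hy1_r₁]⟩,
    fun i hi1 hi2 => ⟨by rw [(hrun4 i hi1 hi2).1, hx_p₃], by rw [(hrun4 i hi1 hi2).2, hy1_p₃]⟩,
    fun i hi1 hi2 => ⟨by rw [(hrun5 i hi1 hi2).1, hx_p₄], by rw [(hrun5 i hi1 hi2).2, hy1_p₄]⟩,
    fun i hi1 hi2 => ⟨by rw [(hrun6 i hi1 hi2).1, hx_r₂], by rw [(hrun6 i hi1 hi2).2, hy1_r₂]⟩,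
    fun i hi1 hi2 => ⟨by rw [(hrun7 i hi1 hi2).1, hx_r₃], by rw [(hrun7 i hi1 hi2).2, hy1_r₃]⟩,
    hR8, hs_eq, hN', hparc_p₂, hparc_r₁, hparc_p₃, hparc_p₄, hparc_r₂, hparc_r₃, hparc_r₄,
    hpos_p₂, hpos_r₁, hpos_p₃, hpos_p₄, hpos_r₂, hpos_r₃, hgap1, hgap2, hgap3, hgap4, hgap5, hn_r₄⟩

end Literature.Probability.RandomPlanarGeometry.SAW.HexBW.Wall
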